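import Summits.BirchSwinnertonDyer.BirchSwinnertonDyer.Theorems.ByReductionTypeAtTwoOrdKatoHalfAtTwoIsoZetaColemanMuSignFreeSupply
import Literature.NumberTheory.EllipticCurves.IwasawaAlgebraInvolution
import HarnessLib

/-!
# Route ByReductionTypeAtTwo, crux `OrdKatoHalfAtTwoIso` (stmt-BirchSwinnertonDyer-19573), line
# `steinberg-fibre-at-two`, child F1μ⁺ `OrdKatoFineZetaAtTwoResidue` (stmt-BirchSwinnertonDyer-23959): the `ι`-SEMILINEAR
# transpose — a map `φ : Sel → S` intertwining `conj_γ − 1` with `ψ` has an `ι`-semilinear transpose `P₀ → X(E/ℚ_∞)` against a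
# dual pair `(P₀, S)` keyed by the INVERSE endomorphism `ψ⁻` (`(1 + ψ⁻)(1 + ψ) = 1`), and the HONEST Selmer-side door: from a
# local Coleman dual pair keyed by `ψ⁻ = conj_{γᵥ}⁻¹ − 1` (the key of the Λ-adic Tate pairing) and `φ = loc₂`, the per-datum
# reading «F1μ⁺ι» with `θ = ι` — no untwist inside the datum

Seat `cruxlead-stmt-BirchSwinnertonDyer-19573-w3` g2 (prover WIDTH under the LEAD `cruxlead-19573` g5; HOME
`run/shared/lean/pub/bsd-2adic/`; `--supports` stmt-BirchSwinnertonDyer-23959). HONEST FRAMING (cell bsd-2adic): BSD is not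
proved by any of this; F1μ⁺/F1μ⁺ι and the crux are NOT proved here; kernel algebra and doors only (no definition, no named fact,
no `sorry`).

WHY THIS FILE (sequel of `…ZetaColemanMuIotaDoor.lean`, p690167, whose module docstring records the finding). The local Tate
pairing `⟨·,·⟩ : 𝐇¹_loc × H¹(ℚ_{∞,2}, E[2^∞]) → ℚ/ℤ` is Galois-EQUIVARIANT, so `⟨(γ − 1)u, s⟩ = ⟨u, (γ⁻¹ − 1)s⟩`: with the
compact side's natural structure `T = conj_{γᵥ} − 1` (`LocalIwasawaH1Data`), the pair `(P₀ = 𝐇¹_loc ⧸ 𝐇¹_loc(F⁺), S, toDualP = ⟨·,·⟩)`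
is an `IwasawaDual.IsDualPair 2 ψ⁻ toDualP` for `ψ⁻ := conj_{γᵥ}⁻¹ − 1`, while `φ = loc₂ : Sel_{2^∞}(E/ℚ_∞) → S` intertwines
`conj_γ − 1` with `ψ := conj_{γᵥ} − 1`; `(1 + ψ⁻)(1 + ψ) = 1 = (1 + ψ)(1 + ψ⁻)`. The doors p682177/p686000/p688256/p690240 ask
for `IsDualPair 2 ψ toDualP` and `φ` intertwining THE SAME `ψ` — an untwist inside the datum (RC-373 (1)(i) ruled R-b for the same
question on crux 19556). This file proves:

* §1 `exists_involSemilinear_transpose` — for dual pairs `(X, S, ψ⁻)` and `(X', S', ψ')` over `Λ = ℤ_p⟦T⟧`, an endomorphism `ψ` of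
  `S` with `(1 + ψ⁻)(1 + ψ) = 1 = (1 + ψ)(1 + ψ⁻)` and an additive `φ : S' → S` with `φ ∘ ψ' = ψ ∘ φ`, there is an
  `ι`-SEMILINEAR `F : X →ₛₗ[ι] X'` (`ι = IwasawaAlgebra.involEquiv p`, `T ↦ (1+T)⁻¹ − 1`) with `toDual' (F x) s' = toDual x (φ s')`.
  Proof = the `𝔪`-adic argument of `IwasawaDual.IsDualPair.exists_linearMap_comp` with ONE new step: `F (T·x) = ι(T)·F x`,
  i.e. `toDual' (((1+T)⁻¹ − 1)·F x) s' = toDual x (ψ⁻ (φ s'))`, proved by induction on the `ψ'`-nilpotence of `s'` from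
  `(1 + T)·((1+T)⁻¹ − 1) = −T` and `ψ⁻ = −(1 + ψ⁻)ψ`.
* §2 `zetaColemanMuIota_datum_of_localDualPair_locTwo_erl` — per datum, from the HONEST inputs (L′) a local Coleman dual pair at `2`
  keyed by `ψ⁻`, injective `col`, `φ = loc₂` intertwining `ψ` and described by its kernel above `2`; (R) reciprocity on a set `G`
  of genuine classes; (E) the ERL shape: the per-datum package of «F1μ⁺ι» — `I`, `Z := Λ·G`, `P := range col`, `ℓ := col ∘ ℓ₀`
  (Λ-linear), `τ := F ∘ col⁻¹ : P →ₛₗ[ι] D.X`, `π` the canonical fine quotient, with (b) `τ (ℓ z) = 0` on `Z`, (c)(d) surjective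
  / exact, (e) the image clause — i.e. EXACTLY the hypothesis `hZι` of `…ZetaColemanMuIotaChain` at this datum with `θ = ι`; and
  `…_locOne_erl` (kernel at ONE place above `2`, p690240). With `…IotaDoor`/`…IotaChain` this gives `μ = 0`, Kato's `μ`-part, B8,
  the residue binder and the crux BY NAME from the honest (L′)(R)(E) — the three typed inputs F1-Col / F1-Dual(ι-keyed)+R / F1-ERLμ.

References: [Kato2004Asterisque] (14.9.3) (p. 240), Prop 17.11 (p. 277), §17.13 (pp. 279–280); [MilneADT2006] I Cor. 2.3
(equivariance of the local pairing); [GreenbergLNM1716] §1 p. 60; [Lang1990] Ch. 5 §1 (the `𝔪`-adic argument);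
[MazurTateTeitelbaum1986Invent] §I.17; [Washington1997] §13.2; tree `IwasawaDualFunctorialityProofs.lean`,
`IwasawaAlgebraInvolution.lean`, p682177, p686000, p688256, p690167, p690240, HOME RC-373 (1).
-/

set_option autoImplicit false
set_option linter.dupNamespace false

noncomputable section

open scoped Classical MatrixGroups ModularForm NumberField
open CongruenceSubgroup WeierstrassCurve Field IsDedekindDomain NumberField
open Literature.NumberTheory.GaloisRepresentations
open Literature.NumberTheory.EllipticCurves Literature.NumberTheory.EllipticCurves.ModularForms
  Literature.NumberTheory.EllipticCurves.GreenbergSelmer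
open Literature.NumberTheory.EllipticCurves.Kato2004
  Literature.NumberTheory.EllipticCurves.Kato2004.EulerSystemValues
open Literature.NumberTheory.EllipticCurves.IwasawaDual
open Literature.NumberTheory.EllipticCurves.Rank1Residual
open Summit.BirchSwinnertonDyer.Rank1Residual Summit.BirchSwinnertonDyer.Rank1Residual.X5
open Summit.BirchSwinnertonDyer.BirchSwinnertonDyer.Theses.ByReductionTypeAtTwo

namespace Summit.BirchSwinnertonDyer.BirchSwinnertonDyer.Theorems.SteinbergFibreAtTwo

/-! ## §1 The `ι`-semilinear transpose of a map intertwining `ψ'` with the INVERSE key -/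

section Transpose

variable {p : ℕ} [Fact p.Prime]
  {S : Type*} [AddCommGroup S] {ψm : AddMonoid.End S}
  {X : Type*} [AddCommGroup X] [Module (IwasawaAlgebra p) X] {toDual : X →+ (S →+ AddCircle (1 : ℚ))}
  {S' : Type*} [AddCommGroup S'] {ψ' : AddMonoid.End S'}
  {X' : Type*} [AddCommGroup X'] [Module (IwasawaAlgebra p) X'] {toDual' : X' →+ (S' →+ AddCircle (1 : ℚ))}

/-- A homomorphism intertwining `ψ'` and `ψ` intertwines their powers. [folklore] -/
theorem map_pow_apply_of_map_apply {ψ : AddMonoid.End S} (φ : S' →+ S) (hφ : ∀ s', φ (ψ' s') = ψ (φ s'))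
    (j : ℕ) (s' : S') : φ ((ψ' ^ j) s') = (ψ ^ j) (φ s') := by
  induction j generalizing s' with
  | zero => simp
  | succ j ih =>
    rw [pow_succ, AddMonoid.End.coe_mul, Function.comp_apply, ih, hφ, pow_succ, AddMonoid.End.coe_mul,
      Function.comp_apply]

/-- **The `ι`-semilinear transpose.** Let `(X, S, ψ⁻, toDual)` and `(X', S', ψ', toDual')` be dual pairs over `Λ = ℤ_p⟦T⟧`
(`IwasawaDual.IsDualPair`: `toDual (T·x) s = toDual x (ψ⁻ s)`), let `ψ` be an endomorphism of `S` INVERSE to `ψ⁻` in the sense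
`(1 + ψ⁻)(1 + ψ) = 1 = (1 + ψ)(1 + ψ⁻)` (print: `ψ⁻ = γ⁻¹ − 1`, `ψ = γ − 1` on the local Kummer group), and let `φ : S' → S` be
additive with `φ ∘ ψ' = ψ ∘ φ` (print: `loc₂` on `Sel_{p^∞}(E/ℚ_∞)`). Then the transpose `x ↦ toDual'⁻¹ (toDual x ∘ φ)` is
`ι`-SEMILINEAR, `ι : T ↦ (1+T)⁻¹ − 1` the Iwasawa involution: `F (f·x) = ι(f)·F x`. Constants: `C_smul` on both sides. `T`:
with `z := ((1+T)⁻¹ − 1)·F x` one has `(1+T)·z = −T·F x`, whence `toDual' z s' + toDual' z (ψ' s') = −toDual x (ψ (φ s'))`, and by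
induction on the `ψ'`-nilpotence of `s'`, `toDual' z s' = toDual x (ψ⁻ (φ s'))` using `ψ⁻ = −ψ − ψ⁻ψ`. Polynomials by induction;
power series through the pieces `S'_n` (truncation on both sides; `ι` preserves `(Tⁿ)`). This is the algebra under «the Λ-adic
Poitou–Tate / Greenberg duality map is `ι`-semilinear» (pen RC-373 (1)). [cite: GreenbergLNM1716, §1 p. 60 (the two Λ-structures on a Pontryagin dual)]
[cite: Lang1990, Ch. 5 §1] [cite: MazurTateTeitelbaum1986Invent, Ch. I §17] -/
theorem exists_involSemilinear_transpose (h : IsDualPair p ψm toDual) (h' : IsDualPair p ψ' toDual')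
    (ψ : AddMonoid.End S) (hψ₁ : (1 + ψm) * (1 + ψ) = 1) (hψ₂ : (1 + ψ) * (1 + ψm) = 1)
    (φ : S' →+ S) (hφ : ∀ s', φ (ψ' s') = ψ (φ s')) :
    ∃ F : X →ₛₗ[((IwasawaAlgebra.involEquiv p).toRingEquiv : IwasawaAlgebra p →+* IwasawaAlgebra p)] X',
      ∀ (x : X) (s' : S'), toDual' (F x) s' = toDual x (φ s') := by
  -- the transpose as an additive map
  let e' : X' ≃+ (S' →+ AddCircle (1 : ℚ)) := AddEquiv.ofBijective toDual' h'.bijective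
  let F₀ : X →+ X' :=
    { toFun := fun x ↦ e'.symm ((toDual x).comp φ)
      map_zero' := by
        apply e'.injective
        rw [AddEquiv.apply_symm_apply, map_zero, map_zero, AddMonoidHom.zero_comp]
      map_add' := fun x y ↦ by
        apply e'.injective
        rw [AddEquiv.apply_symm_apply, map_add, map_add, AddEquiv.apply_symm_apply, AddEquiv.apply_symm_apply,
          AddMonoidHom.add_comp] }
  have hF₀ : ∀ (x : X) (s' : S'), toDual' (F₀ x) s' = toDual x (φ s') := fun x s' ↦ by
    change e' (e'.symm ((toDual x).comp φ)) s' = _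
    rw [AddEquiv.apply_symm_apply, AddMonoidHom.comp_apply]
  -- algebra of the two keys: `ψ⁻ = -ψ - ψ⁻ ψ` and `ψ⁻` commutes with `ψ`
  have hψm_eq : ψm = -((1 + ψm) * ψ) := by
    have h2 : (1 + ψm) * (1 + ψ) = (1 + ψm) + (1 + ψm) * ψ := by rw [mul_add, mul_one]
    rw [hψ₁] at h2
    -- `h2 : 1 = 1 + ψm + (1 + ψm) * ψ`
    have h3 : ψm + (1 + ψm) * ψ = 0 := by
      have h4 : (1 : AddMonoid.End S) + (ψm + (1 + ψm) * ψ) = 1 + 0 := by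
        rw [add_zero, ← add_assoc]
        exact h2.symm
      exact add_left_cancel h4
    exact eq_neg_of_add_eq_zero_left h3
  have hkey : ∀ t : S, ψm t = -(ψ t) - ψm (ψ t) := by
    intro t
    calc ψm t = (-((1 + ψm) * ψ)) t := by rw [← hψm_eq]
      _ = -(ψ t) - ψm (ψ t) := by
          -- pointwise operations on `AddMonoid.End S` are definitional
          show -(ψ t + ψm (ψ t)) = -(ψ t) - ψm (ψ t)
          rw [neg_add']
  have hcomm : Commute (1 + ψm) ψ := by
    have hc : Commute (1 + ψm) (1 + ψ) := by
      change (1 + ψm) * (1 + ψ) = (1 + ψ) * (1 + ψm)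
      rw [hψ₁, hψ₂]
    have hc2 := hc.sub_right (Commute.one_right (1 + ψm))
    rwa [add_sub_cancel_left] at hc2
  have hψm_pow_apply : ∀ (n : ℕ) (t : S), (ψ ^ n) t = 0 → (ψm ^ n) t = 0 := by
    intro n t ht
    have h5 : ψm ^ n = (-((1 + ψm) * ψ)) ^ n := by rw [← hψm_eq]
    rw [h5, neg_pow, hcomm.mul_pow, AddMonoid.End.coe_mul, Function.comp_apply, AddMonoid.End.coe_mul,
      Function.comp_apply, ht, map_zero, map_zero]
  -- constants act alike on both sides
  have hC : ∀ (c : ℤ_[p]) (x : X), F₀ (PowerSeries.C c • x) = PowerSeries.C c • F₀ x := by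
    intro c x
    apply h'.bijective.1
    ext s'
    obtain ⟨k, hk⟩ := h'.locNil.torsion s'
    have hk' : p ^ k • φ s' = 0 := by rw [← map_nsmul, hk, map_zero]
    rw [hF₀, h.C_smul c x (φ s') k hk', h'.C_smul c (F₀ x) s' k hk, hF₀]
  -- the new step: `T` acts on the transpose through `ι(T) = (1+T)⁻¹ − 1`
  have hT : ∀ x : X, F₀ ((PowerSeries.X : IwasawaAlgebra p) • x) = IwasawaAlgebra.invSubOne p • F₀ x := by
    intro x
    set z : X' := IwasawaAlgebra.invSubOne p • F₀ x with hz
    have h1z : (1 + PowerSeries.X : IwasawaAlgebra p) • z = -((PowerSeries.X : IwasawaAlgebra p) • F₀ x) := by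
      rw [hz, ← mul_smul, ← neg_smul]
      congr 1
      have hm := IwasawaAlgebra.one_add_X_mul_one_add_invSubOne p
      rw [mul_add, mul_one] at hm
      -- `hm : (1 + X) + (1 + X) * invSubOne = 1`
      linear_combination (exp := 1) hm
    -- the recursion `toDual' z s' + toDual' z (ψ' s') = - toDual x (ψ (φ s'))`
    have hrec : ∀ s', toDual' z s' = -(toDual x (ψ (φ s'))) - toDual' z (ψ' s') := by
      intro s'
      have hl : toDual' ((1 + PowerSeries.X : IwasawaAlgebra p) • z) s' = toDual' z s' + toDual' z (ψ' s') := by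
        rw [add_smul, one_smul, map_add, AddMonoidHom.add_apply, h'.T_smul]
      have hr : toDual' (-((PowerSeries.X : IwasawaAlgebra p) • F₀ x)) s' = -(toDual x (ψ (φ s'))) := by
        rw [map_neg, AddMonoidHom.neg_apply, h'.T_smul, hF₀, hφ]
      rw [h1z] at hl
      rw [hl] at hr
      exact eq_sub_of_add_eq hr
    -- induction on the `ψ'`-nilpotence of `s'`
    have hind : ∀ (n : ℕ) (s' : S'), (ψ' ^ n) s' = 0 → toDual' z s' = toDual x (ψm (φ s')) := by
      intro n
      induction n with
      | zero =>
        intro s' hs'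
        rw [pow_zero, AddMonoid.End.coe_one, id_eq] at hs'
        rw [hs', map_zero, map_zero, map_zero, map_zero]
      | succ n ih =>
        intro s' hs'
        have hs'' : (ψ' ^ n) (ψ' s') = 0 := by
          rwa [pow_succ, AddMonoid.End.coe_mul, Function.comp_apply] at hs'
        rw [hrec s', ih (ψ' s') hs'', hφ, hkey (φ s'), map_sub, map_neg]
    apply h'.bijective.1
    ext s'
    obtain ⟨n, hn⟩ := h'.locNil.nil s'
    rw [hF₀, h.T_smul, ← hind n s' hn]
  -- powers of `T`
  have hTpow : ∀ (j : ℕ) (x : X), F₀ ((PowerSeries.X : IwasawaAlgebra p) ^ j • x) =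
      IwasawaAlgebra.invSubOne p ^ j • F₀ x := by
    intro j
    induction j with
    | zero => intro x; rw [pow_zero, pow_zero, one_smul, one_smul]
    | succ j ih => intro x; rw [pow_succ', mul_smul, hT, ih, ← mul_smul, ← pow_succ']
  -- polynomials
  have hpoly : ∀ (q : Polynomial ℤ_[p]) (x : X),
      F₀ ((q : IwasawaAlgebra p) • x) = IwasawaAlgebra.invol p (q : IwasawaAlgebra p) • F₀ x := by
    intro q x
    induction q using Polynomial.induction_on' with
    | add q r hq hr => rw [Polynomial.coe_add, add_smul, map_add, map_add, add_smul, hq, hr]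
    | monomial j c =>
      rw [← Polynomial.C_mul_X_pow_eq_monomial, Polynomial.coe_mul, Polynomial.coe_pow, Polynomial.coe_C,
        Polynomial.coe_X, mul_smul, hC, hTpow, map_mul, map_pow, IwasawaAlgebra.invol_C, IwasawaAlgebra.invol_X,
        mul_smul]
  -- `ι` maps `(Tⁿ)` into `(Tⁿ)`: the tail acts into the annihilator of `S'_n`
  have htail : ∀ (n : ℕ) (f : IwasawaAlgebra p), ∀ j < n, (p : ℤ_[p]) ^ n ∣
      PowerSeries.coeff j (IwasawaAlgebra.invol p
        (f - ((PowerSeries.trunc n f : Polynomial ℤ_[p]) : IwasawaAlgebra p))) := by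
    intro n f j hj
    have hX : (PowerSeries.X : IwasawaAlgebra p) ^ n ∣
        f - ((PowerSeries.trunc n f : Polynomial ℤ_[p]) : IwasawaAlgebra p) := by
      rw [PowerSeries.X_pow_dvd_iff]
      intro m hm
      rw [map_sub, Polynomial.coeff_coe, PowerSeries.coeff_trunc, if_pos hm, sub_self]
    obtain ⟨v, hv⟩ := hX
    have hXι : (PowerSeries.X : IwasawaAlgebra p) ^ n ∣
        IwasawaAlgebra.invol p (f - ((PowerSeries.trunc n f : Polynomial ℤ_[p]) : IwasawaAlgebra p)) := by
      rw [hv, map_mul, map_pow, IwasawaAlgebra.invol_X]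
      exact Dvd.dvd.mul_right (pow_dvd_pow_of_dvd
        (PowerSeries.X_dvd_iff.2 (IwasawaAlgebra.constantCoeff_invSubOne p)) n) _
    rw [PowerSeries.X_pow_dvd_iff] at hXι
    rw [hXι j hj]
    exact dvd_zero _
  -- `ι`-semilinearity through the pieces
  have hsmul : ∀ (f : IwasawaAlgebra p) (x : X), F₀ (f • x) = IwasawaAlgebra.invol p f • F₀ x := by
    intro f x
    rw [← sub_eq_zero]
    refine h'.eq_zero_of_forall_mem_annPiece fun n s' hs' ↦ ?_
    have hφs' : φ s' ∈ piece p ψm n := by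
      rw [mem_piece] at hs' ⊢
      refine ⟨by rw [← map_nsmul, hs'.1, map_zero], hψm_pow_apply n (φ s') ?_⟩
      rw [← map_pow_apply_of_map_apply φ hφ, hs'.2, map_zero]
    have hdecomp : IwasawaAlgebra.invol p f =
        IwasawaAlgebra.invol p ((PowerSeries.trunc n f : Polynomial ℤ_[p]) : IwasawaAlgebra p) +
        IwasawaAlgebra.invol p (f - ((PowerSeries.trunc n f : Polynomial ℤ_[p]) : IwasawaAlgebra p)) := by
      rw [← map_add, add_sub_cancel]
    rw [map_sub, AddMonoidHom.sub_apply, sub_eq_zero, hF₀, h.toDual_smul_eq_toDual_trunc_smul f x hφs',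
      ← hF₀, hpoly, hdecomp, add_smul, map_add, AddMonoidHom.add_apply,
      h'.smul_mem_annPiece (htail n f) (F₀ x) s' hs', add_zero]
  refine ⟨{ toFun := F₀, map_add' := F₀.map_add, map_smul' := fun r x ↦ ?_ }, hF₀⟩
  change F₀ (r • x) = IwasawaAlgebra.invol p r • F₀ x
  exact hsmul r x

end Transpose

/-! ## §2 Per datum: the reading «F1μ⁺ι» (`θ = ι`) from the HONEST local Coleman dual pair at `2` -/

section PerDatum

variable {W : WeierstrassCurve ℚ} [W.IsElliptic] [W.IsGloballyMinimal]
  [ContinuousSMul ℤ_[2] (W.tateModule 2)] [Module.Free ℤ_[2] (W.tateModule 2)]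
  [Module.Finite ℤ_[2] (W.tateModule 2)] {N : ℕ} {f : CuspForm (Gamma0 N) 2}
  {κ : ZpExtension ℚ 2} {γ : absoluteGaloisGroup ℚ} {hκ : κ.IsCyclotomic}

/-- **«F1μ⁺ι» per datum from the honest inputs at `2`.** Data/hypotheses (explicit; nothing asserted): the pinned `𝐇¹` `I` and
a SET `G ⊆ 𝐇¹` of GENUINE `2`-adic Euler-system classes; (L′) a local Coleman dual pair at `2` KEYED BY THE INVERSE:
`hP : IsDualPair 2 ψ⁻ toDualP` on `(P₀, S)` — in print `P₀ = 𝐇¹_loc ⧸ 𝐇¹_loc(F⁺)` with `T = conj_{γᵥ} − 1`, `S` the local Kummer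
group, `toDualP` the Λ-adic Tate pairing, `ψ⁻ = conj_{γᵥ}⁻¹ − 1` — an endomorphism `ψ` (`= conj_{γᵥ} − 1`) with
`(1 + ψ⁻)(1 + ψ) = 1 = (1 + ψ)(1 + ψ⁻)`, an INJECTIVE Λ-linear `col : P₀ → Λ` (Prop. 17.11 at `2`), and `φ : Sel → S` intertwining
`conj_γ − 1` with `ψ` (`loc₂`) whose kernel is «restriction to every decomposition group above `2` vanishes»; (R) a Λ-linear
`ℓ₀ : 𝐇¹ → P₀` (`loc₂`) with `toDualP (ℓ₀ g) (φ s) = 0` for `g ∈ G`; (E) the ERL shape (`col (ℓ₀ g) = u·M·L′`, `M ∉ (2)`,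
`ι L′ = C r · L₂(f, α)`, `‖r‖₂ = 1`). CONCLUSION: the per-datum package of the `ι`-aware reading — `Z := Λ·G`, `P := range col`,
`ℓ := col ∘ ℓ₀` (Λ-linear), `τ := F ∘ col⁻¹ : P →ₛₗ[ι] D.X` with `F` the `ι`-semilinear transpose of `φ` (§1), `π` the canonical fine
quotient — with the span clause, `τ (ℓ z) = 0` on `Z` (reciprocity on `G` propagates: `ker (τ ∘ ℓ₀)` is a submodule), `π` onto,
`Function.Exact τ π` (p682177 `exact_transpose_of_ker_eq_range`), and the image clause at `(2)` (p688256 `himgG_of_erlShape`).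
[cite: Kato2004Asterisque, Thm 12.6 (p. 222), (14.9.3) (p. 240), Thm 16.6 (2) (p. 271), Prop 17.11 (p. 277), §17.13 (pp. 279–280)]
[cite: MilneADT2006, Ch. I, Cor. 2.3] [cite: GreenbergLNM1716, §2 Prop 2.1 (p. 72)] -/
theorem zetaColemanMuIota_datum_of_localDualPair_locTwo_erl (D : W.SelmerDualData κ γ)
    (Y : W.FineSelmerDualData κ γ) (I : IwasawaH1Data W 2 κ γ) (G : Set I.H)
    (hG : ∀ g ∈ G, IsEulerSystemClassTwo W hκ I g)
    {P₀ : Type*} [AddCommGroup P₀] [Module (IwasawaAlgebra 2) P₀] {S : Type*} [AddCommGroup S]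
    {ψm : AddMonoid.End S} {toDualP : P₀ →+ (S →+ AddCircle (1 : ℚ))} (hP : IsDualPair 2 ψm toDualP)
    (ψ : AddMonoid.End S) (hψ₁ : (1 + ψm) * (1 + ψ) = 1) (hψ₂ : (1 + ψ) * (1 + ψm) = 1)
    (col : P₀ →ₗ[IwasawaAlgebra 2] IwasawaAlgebra 2) (hcol : Function.Injective col)
    (φ : W.selmerInfty κ →+ S) (hφ : ∀ s, φ ((W.conjSelmerInfty κ γ - 1) s) = ψ (φ s))
    (hφker : ∀ s : W.selmerInfty κ, φ s = 0 ↔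
      ∀ (v : HeightOneSpectrum (𝓞 ℚ)), ((2 : ℕ) : 𝓞 ℚ) ∈ v.asIdeal → ∀ σ : absoluteGaloisGroup ℚ,
        W.conjH1 2 κ.kerSubgroup σ (s : W.subgroupH1 2 κ.kerSubgroup) ∈
          awayKer κ.kerSubgroup (W.geomPrimaryTorsion 2) v)
    (ℓ₀ : I.H →ₗ[IwasawaAlgebra 2] P₀)
    (hrecG : ∀ g ∈ G, ∀ s : W.selmerInfty κ, toDualP (ℓ₀ g) (φ s) = 0)
    (herl : ∃ g ∈ G, ∃ (u : (IwasawaAlgebra 2)ˣ) (M L' : IwasawaAlgebra 2) (r : ℚ_[2]),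
      M ∉ IwasawaAlgebra.augIdealP 2 ∧ ‖r‖ = 1 ∧
        iwasawaToPowerSeries 2 L' = PowerSeries.C r * padicLFunction f (unitRoot W 2 : ℚ_[2]) ∧
        col (ℓ₀ g) = (u : IwasawaAlgebra 2) * M * L') :
    ∃ (θ : IwasawaAlgebra 2 ≃+* IwasawaAlgebra 2) (Z : Submodule (IwasawaAlgebra 2) I.H)
      (P : Submodule (IwasawaAlgebra 2) (IwasawaAlgebra 2))
      (ℓ : I.H →ₗ[IwasawaAlgebra 2] P) (τ : P →ₛₗ[(θ : IwasawaAlgebra 2 →+* IwasawaAlgebra 2)] D.X)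
      (π : D.X →ₗ[IwasawaAlgebra 2] Y.X),
      Z ≤ Submodule.span (IwasawaAlgebra 2) {s : I.H | IsEulerSystemClassTwo W hκ I s} ∧
      (∀ z ∈ Z, τ (ℓ z) = 0) ∧ Function.Surjective π ∧ Function.Exact τ π ∧
      ∀ G₁ : IwasawaAlgebra 2,
        iwasawaToPowerSeries 2 G₁ = padicLFunction f (unitRoot W 2 : ℚ_[2]) →
          ∃ s : IwasawaAlgebra 2, s ∉ IwasawaAlgebra.augIdealP 2 ∧
            s * G₁ ∈ Submodule.map (P.subtype ∘ₗ ℓ) Z := by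
  -- the `ι`-semilinear transpose `F : P₀ → X` of `φ = loc₂`, and the canonical fine quotient `π`
  obtain ⟨F, hF⟩ := exists_involSemilinear_transpose hP (D.isDualPair' W κ) ψ hψ₁ hψ₂ φ hφ
  obtain ⟨π, hπs, hπ⟩ := WeierstrassCurve.FineSelmerDualData.exists_linearMap_ofSelmerDual W κ D Y
  have hker : ∀ s : W.selmerInfty κ, φ s = 0 ↔ (s : W.subgroupH1 2 κ.kerSubgroup) ∈ W.fineSelmerInfty κ :=
    hker_of_kernel_above_two φ hφker
  have hker' : ∀ s : W.selmerInfty κ,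
      φ s = 0 ↔ s ∈ (AddSubgroup.inclusion (W.fineSelmerInfty_le_selmerInfty κ)).range := by
    intro s
    rw [hker, AddMonoidHom.mem_range]
    constructor
    · intro hs
      exact ⟨⟨(s : W.subgroupH1 2 κ.kerSubgroup), hs⟩, Subtype.ext rfl⟩
    · rintro ⟨s₀, rfl⟩
      exact s₀.2
  have hexact : Function.Exact F π :=
    exact_transpose_of_ker_eq_range D.bijective Y.bijective.1 hP.bijective.2
      (AddSubgroup.inclusion (W.fineSelmerInfty_le_selmerInfty κ)) φ hker' hπ hF
  -- reciprocity on `G` propagates to `Z := Λ·G`: `{z | F (ℓ₀ z) = 0}` is a submodule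
  have hZ0 : ∀ z ∈ Submodule.span (IwasawaAlgebra 2) G, F (ℓ₀ z) = 0 := by
    have hle : Submodule.span (IwasawaAlgebra 2) G ≤ (LinearMap.ker F).comap ℓ₀ := by
      rw [Submodule.span_le]
      intro g hg
      rw [SetLike.mem_coe, Submodule.mem_comap, LinearMap.mem_ker]
      exact transpose_eq_zero_of_pairing_eq_zero D.bijective.1 φ hF (hrecG g hg)
    intro z hz
    have := hle hz
    rwa [Submodule.mem_comap, LinearMap.mem_ker] at this
  -- Coleman coordinates: `P := range col ≅ P₀`
  let e : P₀ ≃ₗ[IwasawaAlgebra 2] LinearMap.range col := LinearEquiv.ofInjective col hcol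
  have he : ∀ x : P₀, e.symm (col.rangeRestrict x) = x := fun x => by
    rw [LinearEquiv.symm_apply_eq]
    ext
    simp [e, LinearEquiv.ofInjective_apply]
  refine ⟨(IwasawaAlgebra.involEquiv 2).toRingEquiv, Submodule.span (IwasawaAlgebra 2) G, LinearMap.range col,
    col.rangeRestrict ∘ₗ ℓ₀, F.comp e.symm.toLinearMap, π, Submodule.span_mono fun g hg => hG g hg, ?_, hπs, ?_, ?_⟩
  · -- (b) `τ (ℓ z) = 0` on `Z`
    intro z hz
    change F (e.symm (col.rangeRestrict (ℓ₀ z))) = 0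
    rw [he]
    exact hZ0 z hz
  · -- (d) exactness at `X`: `range (F ∘ e⁻¹) = range F`
    intro x
    refine (hexact x).trans ⟨?_, ?_⟩
    · rintro ⟨u, hu⟩
      exact ⟨e u, by change F (e.symm (e u)) = x; rw [LinearEquiv.symm_apply_apply]; exact hu⟩
    · rintro ⟨v, hv⟩
      exact ⟨e.symm v, hv⟩
  · -- (e) the image clause, transported to `range col`, from the ERL shape
    intro G₁ hG₁
    obtain ⟨g, hg, s, hs, hsG⟩ := himgG_of_erlShape G col ℓ₀ herl G₁ hG₁
    refine ⟨s, hs, ⟨g, Submodule.subset_span hg, ?_⟩⟩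
    rw [← hsG]
    rfl

end PerDatum

end Summit.BirchSwinnertonDyer.BirchSwinnertonDyer.Theorems.SteinbergFibreAtTwo

end
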